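import Summits.ResolutionOfSingularities.ResolutionOfSingularities.Theorems.ConeExit.Negative.Mirror

/-!
# `NoPeriodicIsolatedAtom` (crux stmt-ResolutionOfSingularities-16344, line `ridge_rank`):
# the stub `stub_orderWindow` — THE RIDGE ARENA, algebraic half

Over the exact mirror `Theorems/ConeExit/Negative/Mirror.lean` of the crux's calculus we prove: in
dimension `n ≥ 3`, over any field `K`, a coefficient function `c'` whose cleaned series `a' = ser p c'`
is divisible by `u_i` (every cleaned coefficient at an exponent `B` with `B i = 0` vanishes) cannot be
ISOLATED (`K[[u]] ⧸ (∂a')` module-finite over `K`) of MULTIPLICITY `p` (all cleaned monomials in total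
degree `≥ p`).

Proof. `a' = u_i · q`; multiplicity `p ≥ 2` kills the monomial `u_i`, so `q(0) = 0`; the Leibniz rule
puts the Jacobian ideal inside `I = (u_i, q)`; finiteness of `K[[u]] ⧸ (∂a')` makes that ring Artinian,
so a power of every variable lies in `(∂a') ⊆ I`; killing `u_i` (the ring endomorphism
`rescale (update 1 i 0)`) turns `u_j ^ a, u_k ^ b ∈ I` (`j ≠ k`, both `≠ i`, available as `n ≥ 3`)
into `q|_{u_i = 0} ∣ u_j ^ a` and `∣ u_k ^ b`, forcing `q|_{u_i = 0}` to be a unit — but its constant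
coefficient is `q(0) = 0`.
-/

noncomputable section

-- single-problem summit: the doubled namespace component is forced by the tree layout
set_option linter.dupNamespace false

namespace Summit.ResolutionOfSingularities.ResolutionOfSingularities.Theorems.NoPeriodicIsolatedAtom.RidgeRank

open Summit.ResolutionOfSingularities.ResolutionOfSingularities.Theorems.ConeExit.Negative
open MvPowerSeries

/-! ## Generic power-series lemmas -/

section Generic

variable {σ : Type*} {K : Type*} [Field K]

/-- Coefficients of `X s ^ d * φ`. [folklore] -/
theorem coeff_X_pow_mul' (s : σ) (d : ℕ) (φ : MvPowerSeries σ K) (e : σ →₀ ℕ) :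
    coeff e (X s ^ d * φ) = if d ≤ e s then coeff (e - Finsupp.single s d) φ else 0 := by
  rw [X_pow_eq, coeff_monomial_mul, one_mul]
  by_cases h : d ≤ e s
  · rw [if_pos (Finsupp.single_le_iff.mpr h), if_pos h]
  · rw [if_neg (fun hle => h (Finsupp.single_le_iff.mp hle)), if_neg h]

/-- Coefficients of `X s * φ`. [folklore] -/
theorem coeff_X_mul' (s : σ) (φ : MvPowerSeries σ K) (e : σ →₀ ℕ) :
    coeff e (X s * φ) = if 1 ≤ e s then coeff (e - Finsupp.single s 1) φ else 0 := by
  rw [← coeff_X_pow_mul', pow_one]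

/-- If `X k ^ b ∣ X j ^ a * w` with `j ≠ k`, then `X k ^ b ∣ w`. [folklore] -/
theorem X_pow_dvd_of_X_pow_dvd_X_pow_mul {j k : σ} (hjk : j ≠ k) {a b : ℕ}
    {w : MvPowerSeries σ K} (h : (X k : MvPowerSeries σ K) ^ b ∣ X j ^ a * w) :
    (X k : MvPowerSeries σ K) ^ b ∣ w := by
  classical
  rw [X_pow_dvd_iff] at h ⊢
  intro m hm
  have h1 := h (m + Finsupp.single j a) (by
    rw [Finsupp.add_apply, Finsupp.single_apply, if_neg hjk, add_zero]; exact hm)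
  rwa [coeff_X_pow_mul', if_pos (by simp), add_tsub_cancel_right] at h1

/-- `X k ^ b` is a non-zero power series. [folklore] -/
theorem X_pow_ne_zero' (k : σ) (b : ℕ) : (X k : MvPowerSeries σ K) ^ b ≠ 0 := by
  classical
  intro h0
  have h := congrArg (coeff (Finsupp.single k b)) h0
  rw [coeff_X_pow, if_pos rfl, map_zero] at h
  exact one_ne_zero h

/-- A common divisor of `X j ^ a` and `X k ^ b` (`j ≠ k`) is a unit. [folklore] -/
theorem isUnit_of_dvd_X_pow_of_dvd_X_pow {j k : σ} (hjk : j ≠ k) {a b : ℕ}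
    {g : MvPowerSeries σ K} (hj : g ∣ X j ^ a) (hk : g ∣ X k ^ b) : IsUnit g := by
  obtain ⟨u, hu⟩ := hj
  obtain ⟨v, hv⟩ := hk
  have h1 : (X k : MvPowerSeries σ K) ^ b ∣ X j ^ a * v := ⟨u, by rw [hu, hv]; ring⟩
  obtain ⟨v', hv'⟩ := X_pow_dvd_of_X_pow_dvd_X_pow_mul hjk h1
  have h2 : (X k : MvPowerSeries σ K) ^ b * (g * v') = X k ^ b * 1 := by
    rw [mul_one, mul_left_comm, ← hv', ← hv]
  exact isUnit_iff_dvd_one.mpr ⟨v', (mul_left_cancel₀ (X_pow_ne_zero' k b) h2).symm⟩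

/-- The constant coefficient is unchanged by rescaling the variables. [folklore] -/
theorem constantCoeff_rescale' (a : σ → K) (f : MvPowerSeries σ K) :
    constantCoeff (rescale a f) = constantCoeff f := by
  rw [← coeff_zero_eq_constantCoeff_apply, ← coeff_zero_eq_constantCoeff_apply f, coeff_rescale,
    Finsupp.prod_zero_index, one_mul]

/-- **Converse `Isol` certificate.** If `K[[X]] ⧸ J` is module-finite over `K`, then some power of
each variable lies in `J` (the quotient is Artinian, so `x ^ N = x ^ (N + 1) y` for `x = X s`, and
`1 - X s * y` is a unit). [folklore] -/
theorem exists_X_pow_mem_of_moduleFinite (J : Ideal (MvPowerSeries σ K))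
    [Module.Finite K (MvPowerSeries σ K ⧸ J)] (s : σ) :
    ∃ N : ℕ, (X s : MvPowerSeries σ K) ^ N ∈ J := by
  haveI : IsArtinianRing (MvPowerSeries σ K ⧸ J) := IsArtinianRing.of_finite K _
  obtain ⟨N, y, hy⟩ := IsArtinian.exists_pow_succ_smul_dvd (M := MvPowerSeries σ K ⧸ J)
    (Ideal.Quotient.mk J (X s)) 1
  obtain ⟨y, rfl⟩ := Ideal.Quotient.mk_surjective y
  refine ⟨N, ?_⟩
  have hmem : X s ^ N * (1 - X s * y) ∈ J := by
    rw [← Ideal.Quotient.eq_zero_iff_mem, mul_sub, mul_one, ← mul_assoc, ← pow_succ]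
    simp only [map_sub, map_mul, map_pow]
    rw [sub_eq_zero]
    rw [smul_eq_mul, smul_eq_mul, mul_one] at hy
    exact hy.symm
  have hu : IsUnit (1 - X s * y) := by
    rw [isUnit_iff_constantCoeff, map_sub, map_one, map_mul, constantCoeff_X, zero_mul, sub_zero]
    exact isUnit_one
  exact (Ideal.mul_unit_mem_iff_mem J hu).mp hmem

/-! ### Killing one variable: the ring endomorphism `rescale (update 1 i 0)` (`u_i ↦ 0`) -/

variable [DecidableEq σ]

/-- Coefficients after killing `u_i`: those with `m i = 0` survive, the others die. [folklore] -/
theorem coeff_rescale_update (i : σ) (f : MvPowerSeries σ K) (m : σ →₀ ℕ) :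
    coeff m (rescale (Function.update 1 i 0) f) = if m i = 0 then coeff m f else 0 := by
  rw [coeff_rescale]
  simp only [Finsupp.prod]
  by_cases hm : m i = 0
  · rw [if_pos hm, Finset.prod_eq_one, one_mul]
    intro s hs
    have hsi : s ≠ i := fun h => by rw [h, Finsupp.mem_support_iff] at hs; exact hs hm
    rw [Function.update_of_ne hsi, Pi.one_apply, one_pow]
  · rw [if_neg hm, Finset.prod_eq_zero (Finsupp.mem_support_iff.mpr hm), zero_mul]
    rw [Function.update_self, zero_pow hm]

/-- Killing `u_i` kills `u_i`. [folklore] -/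
theorem rescale_update_X_self (i : σ) :
    rescale (Function.update 1 i 0) (X i : MvPowerSeries σ K) = 0 := by
  ext m
  rw [coeff_rescale_update, coeff_X, map_zero]
  by_cases hm : m = Finsupp.single i 1
  · rw [if_pos hm, if_neg]
    rw [hm, Finsupp.single_eq_same]; exact one_ne_zero
  · rw [if_neg hm, ite_self]

/-- Killing `u_i` fixes the other variables. [folklore] -/
theorem rescale_update_X_of_ne {i j : σ} (hji : j ≠ i) :
    rescale (Function.update 1 i 0) (X j : MvPowerSeries σ K) = X j := by
  ext m
  rw [coeff_rescale_update, coeff_X]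
  by_cases hm : m = Finsupp.single j 1
  · rw [if_pos hm, if_pos]
    rw [hm, Finsupp.single_apply, if_neg hji]
  · rw [if_neg hm, ite_self]

/-- If `X s ^ N ∈ (X i, q)` with `s ≠ i`, then `q|_{u_i = 0}` divides `X s ^ N`. [folklore] -/
theorem rescale_dvd_X_pow_of_mem_span_pair {i s : σ} (hsi : s ≠ i) {q : MvPowerSeries σ K}
    {N : ℕ} (h : (X s : MvPowerSeries σ K) ^ N ∈ Ideal.span {(X i : MvPowerSeries σ K), q}) :
    rescale (Function.update 1 i 0) q ∣ X s ^ N := by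
  obtain ⟨a, b, hab⟩ := Ideal.mem_span_pair.mp h
  refine ⟨rescale (Function.update 1 i 0) b, ?_⟩
  have h1 := congrArg (rescale (Function.update (1 : σ → K) i 0)) hab
  rw [map_add, map_mul, map_mul, map_pow, rescale_update_X_self, rescale_update_X_of_ne hsi,
    mul_zero, zero_add] at h1
  rw [← h1, mul_comm]

end Generic

/-! ## The formal partial derivatives of `u_i · q` (over the mirror's `pd`) -/

section Pd

variable {n : ℕ} {K : Type} [Field K]

/-- Coefficients of the mirror's `pd`. [folklore] -/
theorem coeff_pd (k : Fin n) (f : MvPowerSeries (Fin n) K) (A : Fin n →₀ ℕ) :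
    coeff A (pd k f) = ((A k + 1 : ℕ) : K) * coeff (A + Finsupp.single k 1) f :=
  rfl

/-- `∂_k (u_i q) = u_i ∂_k q` for `k ≠ i`. [folklore] -/
theorem pd_X_mul_of_ne {k i : Fin n} (hki : k ≠ i) (q : MvPowerSeries (Fin n) K) :
    pd k (X i * q) = X i * pd k q := by
  ext A
  simp only [coeff_pd, coeff_X_mul']
  have h1 : (A + Finsupp.single k 1 : Fin n →₀ ℕ) i = A i := by
    rw [Finsupp.add_apply, Finsupp.single_apply, if_neg hki, add_zero]
  have h2 : (A - Finsupp.single i 1 : Fin n →₀ ℕ) k = A k := by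
    rw [Finsupp.tsub_apply, Finsupp.single_apply, if_neg (Ne.symm hki), tsub_zero]
  rw [h1, h2]
  by_cases hA : 1 ≤ A i
  · have h3 : A + Finsupp.single k 1 - Finsupp.single i 1 =
        A - Finsupp.single i 1 + Finsupp.single k 1 := by
      ext l
      simp only [Finsupp.tsub_apply, Finsupp.add_apply, Finsupp.single_apply]
      by_cases hil : i = l
      · subst hil
        rw [if_neg hki, if_pos rfl]; omega
      · rw [if_neg hil]; split_ifs <;> omega
    rw [if_pos hA, if_pos hA, h3]
  · rw [if_neg hA, if_neg hA, mul_zero]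

/-- `∂_i (u_i q) = q + u_i ∂_i q`. [folklore] -/
theorem pd_X_mul_self (i : Fin n) (q : MvPowerSeries (Fin n) K) :
    pd i (X i * q) = q + X i * pd i q := by
  ext A
  simp only [coeff_pd, coeff_X_mul', map_add]
  have h1 : (A + Finsupp.single i 1 : Fin n →₀ ℕ) i = A i + 1 := by
    rw [Finsupp.add_apply, Finsupp.single_eq_same]
  rw [h1, if_pos (Nat.le_add_left 1 _), add_tsub_cancel_right]
  by_cases hA : 1 ≤ A i
  · rw [if_pos hA, tsub_add_cancel_of_le (Finsupp.single_le_iff.mpr hA)]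
    have h2 : (A - Finsupp.single i 1 : Fin n →₀ ℕ) i + 1 = A i := by
      rw [Finsupp.tsub_apply, Finsupp.single_eq_same]; omega
    rw [h2]; push_cast; ring
  · rw [if_neg hA, add_zero]
    have h3 : A i = 0 := by omega
    rw [h3, Nat.zero_add, Nat.cast_one, one_mul]

end Pd

/-! ## The stub -/

/-- **`stub_orderWindow` — THE RIDGE ARENA, algebraic half.** In dimension `n ≥ 3`, over any field,
a coefficient function `c'` whose cleaned series is divisible by `u_i` (all cleaned coefficients at
exponents `B` with `B i = 0` vanish) cannot be isolated (`K[[u]] ⧸ (∂a')` module-finite) of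
multiplicity `p` (all cleaned monomials in degree `≥ p`): `a' = u_i q`, `q(0) = 0`, `(∂a') ⊆ (u_i, q)`,
a power of each variable lies in `(∂a')`, and killing `u_i` makes `q|_{u_i=0}` a common divisor of
`u_j ^ a` and `u_k ^ b` for two further indices `j ≠ k`, hence a unit with constant coefficient `0`.
[folklore] -/
theorem stub_orderWindow :
    ∀ p : ℕ, p.Prime → ∀ n : ℕ, 3 ≤ n → ∀ (K : Type) [Field K] (c' : (Fin n → ℕ) → K) (i : Fin n),
    (∀ B : Fin n → ℕ, B i = 0 → clean p c' B = 0) →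
    Module.Finite K (MvPowerSeries (Fin n) K ⧸ jac p c') →
    ((∃ A, clean p c' A ≠ 0) ∧ ∀ A, clean p c' A ≠ 0 → p ≤ Finset.sum Finset.univ (fun j => A j)) →
    False := by
  intro p hp n hn K _ c' i hdiv hfin hmult
  -- (1) `u_i` divides the cleaned series: `a' = u_i q`
  obtain ⟨q, hq⟩ : (X i : MvPowerSeries (Fin n) K) ∣ ser p c' :=
    X_dvd_iff.mpr fun m hm => by rw [coeff_ser]; exact hdiv m hm
  -- (2) multiplicity `p ≥ 2` kills the monomial `u_i`, so `q (0) = 0`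
  have hq0 : constantCoeff q = 0 := by
    have h1 : coeff (Finsupp.single i 1) (ser p c') = 0 := by
      rw [coeff_ser]
      by_contra h
      have h2 := hmult.2 _ h
      have h3 : Finset.sum Finset.univ (fun j => (Finsupp.single i 1 : Fin n →₀ ℕ) j) = 1 := by
        simp [Finsupp.single_apply]
      rw [h3] at h2
      have h4 := hp.two_le
      omega
    rw [hq, coeff_X_mul', Finsupp.single_eq_same, if_pos le_rfl, tsub_self,
      coeff_zero_eq_constantCoeff_apply] at h1
    exact h1
  -- (3) the Jacobian ideal lies in `I = (u_i, q)` (Leibniz)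
  have hjac : jac p c' ≤ Ideal.span {(X i : MvPowerSeries (Fin n) K), q} := by
    show Ideal.span (Set.range fun k => pd k (ser p c')) ≤ _
    rw [Ideal.span_le]
    rintro _ ⟨k, rfl⟩
    show pd k (ser p c') ∈ Ideal.span {(X i : MvPowerSeries (Fin n) K), q}
    rw [hq]
    by_cases hk : k = i
    · rw [hk, pd_X_mul_self]
      exact Ideal.add_mem _ (Ideal.subset_span (by simp))
        (Ideal.mul_mem_right _ _ (Ideal.subset_span (by simp)))
    · rw [pd_X_mul_of_ne hk]
      exact Ideal.mul_mem_right _ _ (Ideal.subset_span (by simp))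
  -- (4)/(5) `K[[u]] ⧸ (∂a')` is Artinian: a power of every variable lies in `(∂a') ⊆ I`
  haveI := hfin
  have hpow : ∀ s : Fin n, ∃ N : ℕ,
      (X s : MvPowerSeries (Fin n) K) ^ N ∈ Ideal.span {(X i : MvPowerSeries (Fin n) K), q} :=
    fun s => (exists_X_pow_mem_of_moduleFinite (jac p c') s).imp fun _ h => hjac h
  -- two further indices `j ≠ k`, both `≠ i` (here `n ≥ 3` is used)
  obtain ⟨j, hj, k, hk, hjk⟩ := Finset.one_lt_card.mp
    (show 1 < (Finset.univ.erase i).card by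
      rw [Finset.card_erase_of_mem (Finset.mem_univ i), Finset.card_univ, Fintype.card_fin]; omega)
  have hji : j ≠ i := Finset.ne_of_mem_erase hj
  have hki : k ≠ i := Finset.ne_of_mem_erase hk
  obtain ⟨Nj, hNj⟩ := hpow j
  obtain ⟨Nk, hNk⟩ := hpow k
  -- (6) kill `u_i`: `q|_{u_i = 0}` divides `u_j ^ Nj` and `u_k ^ Nk`, hence is a unit; but `q(0) = 0`
  have hu : IsUnit (rescale (Function.update 1 i 0) q) :=
    isUnit_of_dvd_X_pow_of_dvd_X_pow hjk (rescale_dvd_X_pow_of_mem_span_pair hji hNj)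
      (rescale_dvd_X_pow_of_mem_span_pair hki hNk)
  rw [isUnit_iff_constantCoeff, constantCoeff_rescale', hq0] at hu
  exact not_isUnit_zero hu

end Summit.ResolutionOfSingularities.ResolutionOfSingularities.Theorems.NoPeriodicIsolatedAtom.RidgeRank

end
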